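import Summits.Ventures.KdS.RouteWEulerRL
import Literature.Geometry.Lorentzian.KerrDeSitterHiddenSymmetryRealAxis
import HarnessLib

/-!
# Venture KdS — ROUTE W on the REAL AXIS: Casals–Teixeira da Costa's Theorem 3.10, second bullet
# (`ω ∈ ℝ∖{0}`), for every spin `s < 1` — PROVED (no cited fact, no open hypothesis)

HONEST FRAMING (venture `Summits/Ventures/KdS`, cell `pub-kds`, seat LIT-1 g7; NOT a result about the
cell's boxes by itself): the cell's displayed CLOSED-half-plane theorems (`noModeClosed_atlas_*`,
`b0TheoremClosed_*`, `msTruncClosed_*`) bind the cited fact H1′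
`CasalsTeixeiraDaCosta2022_theorem310` ONLY through its real-axis bullet (`.realAxis_absurd`, used at
`s = −2`; the `s = 0` column is already hypothesis-free, `ClosedHalfPlaneScalarFree.lean`). This file
gives that bullet, for every `s < 1`, the same treatment route W gave the `Im ω > 0` bullet:

* `SwappedRealAxisVanishing` — Step 2 of the printed proof at `Im ω = 0` as a statement of real
  analysis (the shape of `SwappedEnergyVanishing` with the real-axis hypotheses `Im ω = 0`, `ω ≠ 0`,
  `Im λ̄ = 0`, `m = 0 ∨ ω/m ∉ (Ω_low, Ω_SR)`), and `swappedRealAxisVanishing_holds` — PROVED, by the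
  Literature theorem `KerrDeSitter.ctdcStep2Real_of_normalFormModeData`
  (`Literature/Geometry/Lorentzian/KerrDeSitterHiddenSymmetryRealAxis.lean`: the (3.25) coefficient
  is real, the Wronskian flux `Im(R̃′R̃̄)` is conserved, its horizon values give the printed identity
  `ω[(ω−mϖ₁) − (ω−mϖ₀)κ₁/κ₀]|ũ(−∞)|² + ω[(ω−mϖ₂)+(ω−mϖ₀)κ₂/κ₀]|ũ(+∞)|² = 0`, one amplitude vanishes
  off the window, unique continuation at that regular singular point);
* `realAxis_vanishing_of_routeW_nonres_lt_one : Transfer → EulerRLNonRes → GaugeGlue →`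
  `SwappedRealAxisVanishing → …` — the route-W composition on the real axis for `s < 1`: the
  event-horizon branch `ρ = 2η₁ − s` has `Re ρ = −s > −1` iff `s < 1` (no `Im ω` needed), and the
  NON-RESONANCE of `EulerRLNonRes` is AUTOMATIC on the real axis (`ρ + η − 1 = 2(η₀+η₁)` is purely
  imaginary, `re_two_mul_eta_add_eq_zero`);
* `realAxis_vanishing_lt_one` — with the landed `transfer_holds`, `eulerRLNonRes_holds`
  (`RouteWEulerRL.lean`), `gaugeGlue_holds` and `swappedRealAxisVanishing_holds`: every
  generic-boundary radial Teukolsky mode with `s < 1`, `ω ∈ ℝ∖{0}`, `Im λ̄ = 0` and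
  `m = 0 ∨ ω/m ∉ (Ω_low, Ω_SR)` vanishes — CTdC Theorem 3.10's second bullet for `s < 1`, PROVED with
  NO cited fact and NO open hypothesis; the closed-half-plane theorems are re-bound without `h1` in
  `ClosedHalfPlaneRouteWReal.lean`.

Nothing here touches the records, the window constants or the tables. The half-integer clause
`|s| ∈ {½, 3/2}` of the printed bullet (no frequency condition; printed via Step 1 and the
Teukolsky–Starobinsky identities) is NOT claimed.

References: Casals–Teixeira da Costa, Commun. Math. Phys. 394 (2022) 797–832
[CasalsTeixeiradacosta2022] Thm 3.10 (proof, Step 2, the case `Im ω = 0`), Cor. 3.9 (3.25)–(3.26);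
K. Takemura, J. Math. Soc. Japan 69 (2017) 849–891 [Takemura2017] Prop. 1.2.
-/

noncomputable section

open Set Complex

namespace Summit.Ventures.KdS

namespace RouteW

open Literature.Analysis.ODE Literature.Analysis.ODE.GeneralHeun
open Literature.Geometry.Lorentzian Literature.Geometry.Lorentzian.KerrDeSitter

/-! ### K₂ʳ — Step 2 at a real frequency, as a statement, and its proof -/

/-- **K₂ʳ — CTdC Theorem 3.10, proof Step 2 at `Im ω = 0`, as a statement** (shape of
`SwappedEnergyVanishing`): for subextremal `(M,a,Λ)`, `0 ≤ a`, `Im ω = 0`, `ω ≠ 0`, `Im λ̄ = 0` and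
`m = 0 ∨ ω/m ∉ (Ω_low, Ω_SR)`, every normal-form mode datum of the SWAPPED equation (3.25) —
coefficient `tildeCoeff`, exponents `½ + η₀ + η₁` at `1` and `½ − η₀ − η₂` at `z₂` (3.26) — vanishes
identically on `(1, z₂)`. [cite: CasalsTeixeiradacosta2022, Theorem 3.10 (proof, Step 2, the case Im ω = 0)] -/
def SwappedRealAxisVanishing : Prop :=
  ∀ (M a Λ s : ℝ) (ω : ℂ) (m : ℝ) (lam : ℂ) (Rt : ℝ → ℂ), IsSubextremal M a Λ → 0 ≤ a →
    ω.im = 0 → ω ≠ 0 → (lambdaBar a Λ s ω m lam).im = 0 →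
    (m = 0 ∨ ¬(superradiantLower M a Λ < ω.re / m ∧ ω.re / m < superradiantUpper M a Λ)) →
    NormalFormModeData (zTwo M a Λ) (tildeCoeff M a Λ s ω m lam)
        (1 / 2 + etaCauchy M a Λ ω m + etaEvent M a Λ ω m)
        (1 / 2 - etaCauchy M a Λ ω m - etaCosmo M a Λ ω m) Rt →
      ∀ z ∈ Ioo 1 (zTwo M a Λ), Rt z = 0

/-- **K₂ʳ holds** (LIT-1's `ctdcStep2Real_of_normalFormModeData`; `zTwo`, `tildeCoeff`, `ltBlock`
unfold definitionally). [cite: CasalsTeixeiradacosta2022, Theorem 3.10 (proof, Step 2, the case Im ω = 0) with Corollary 3.9 (3.25)–(3.26)] -/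
theorem swappedRealAxisVanishing_holds : SwappedRealAxisVanishing := by
  intro M a Λ s ω m lam Rt hsub ha hω hω0 hlam hthird hD
  obtain ⟨hode, h1, h2⟩ := hD
  exact Literature.Geometry.Lorentzian.KerrDeSitter.ctdcStep2Real_of_normalFormModeData
    hsub ha hω hω0 hlam hthird hode h1 h2

/-! ### Non-resonance is automatic on the real axis -/

/-- At a real frequency the target exponent `ρ + η − 1 = 2(η₀ + η₁)` of the hidden-symmetry transform
is purely imaginary (`Re η₀ = −Im ω/(2κ₀)`, `Re η₁ = Im ω/(2κ₁)`). [cite: CasalsTeixeiradacosta2022, (3.10)] -/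
theorem re_two_mul_eta_add_eq_zero {M a Λ : ℝ} {ω : ℂ} (hω : ω.im = 0) (m : ℝ) :
    (2 * (etaCauchy M a Λ ω m + etaEvent M a Λ ω m)).re = 0 := by
  simp [Complex.mul_re, add_re, add_im, etaCauchy_re, etaEvent_re, hω]

/-- Hence the non-resonance hypothesis of `EulerRLNonRes` holds at every real frequency:
`2(η₀ + η₁) ≠ −(n+1)`. [cite: CasalsTeixeiradacosta2022, (3.10)] -/
theorem nonres_of_real {M a Λ : ℝ} {ω : ℂ} (hω : ω.im = 0) (m : ℝ) (n : ℕ) :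
    2 * (etaCauchy M a Λ ω m + etaEvent M a Λ ω m) ≠ -((n : ℂ) + 1) := by
  intro h
  have hre := re_two_mul_eta_add_eq_zero (M := M) (a := a) (Λ := Λ) hω m
  rw [h] at hre
  simp at hre
  have : (0 : ℝ) ≤ (n : ℝ) := n.cast_nonneg
  linarith

/-! ### The route-W composition on the real axis -/

/-- **Route W on the real axis, spins `s < 1`** (covers the cell's `s = −2` and `s = 0`):
`Transfer`, `EulerRLNonRes`, `GaugeGlue` and `SwappedRealAxisVanishing` imply that every
generic-boundary radial mode with `ω ∈ ℝ∖{0}`, `Im λ̄ = 0` and `m = 0 ∨ ω/m ∉ (Ω_low, Ω_SR)` vanishes.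
PROVED (the composition is kernel-checked); `Re ρ = −s > −1` and non-resonance need no `Im ω > 0`.
[cite: CasalsTeixeiradacosta2022, Theorem 3.10 (second bullet) via Corollary 3.9 and proof Step 2] -/
theorem realAxis_vanishing_of_routeW_nonres_lt_one (kA : Transfer) (kB : EulerRLNonRes)
    (kG : GaugeGlue) (k2 : SwappedRealAxisVanishing) {M a Λ s : ℝ} {ω : ℂ} {m : ℝ} {lam : ℂ}
    {R : ℝ → ℂ} (hsub : IsSubextremal M a Λ) (ha : 0 ≤ a) (hs : s < 1) (hω : ω.im = 0)
    (hω0 : ω ≠ 0) (hlam : (lambdaBar a Λ s ω m lam).im = 0)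
    (hthird : m = 0 ∨
      ¬(superradiantLower M a Λ < ω.re / m ∧ ω.re / m < superradiantUpper M a Λ))
    (hR : IsRadialTeukolskySolution M a Λ s ω m lam R) (hin : IsIngoingAtEventHorizon M a Λ s ω m R)
    (hout : IsOutgoingAtCosmoHorizon M a Λ ω m R) :
    ∀ r ∈ Ioo (rPlus M a Λ) (rCosmo M a Λ), R r = 0 := by
  obtain ⟨hz₂, v, hv, hvR⟩ := kA M a Λ s ω m lam R hsub hR hin hout
  -- abbreviations
  set η₀ := etaCauchy M a Λ ω m with hη₀
  set η₁ := etaEvent M a Λ ω m with hη₁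
  set η₂ := etaCosmo M a Λ ω m with hη₂
  set z₂ := zTwo M a Λ with hz₂def
  -- the Euler step: source exponent η = α = 1 + s + 2η₀
  have hF := eulerGauge_fuchs (mass₁ M a Λ s ω m) (mass₂ M a Λ ω m) (mass₃ M a Λ s ω m)
    (mass₄ M a Λ ω m)
  have hroot := euler_exponent_root (mass₂ M a Λ ω m) (mass₃ M a Λ s ω m) (mass₄ M a Λ ω m)
  have hρ : 2 * etaEvent M a Λ ω m - (s : ℂ) =
      1 - eulerGaugeδ (mass₁ M a Λ s ω m) (mass₂ M a Λ ω m) := by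
    unfold mass₁ mass₂
    rw [eulerGaugeδ_eta]
    ring
  -- `Re ρ = −s > −1` at a real frequency, for `s < 1`
  have hre : -1 < (2 * etaEvent M a Λ ω m - (s : ℂ)).re := by
    have h1 : (2 * etaEvent M a Λ ω m - (s : ℂ)).re = 2 * (etaEvent M a Λ ω m).re - s := by
      simp [Complex.mul_re]
    rw [h1, etaEvent_re, hω]
    simp only [zero_div, mul_zero, zero_sub]
    linarith
  -- NON-RESONANCE: `ρ + η − 1 = 2(η₀ + η₁)` is purely imaginary at a real frequency
  have hnr : ∀ n : ℕ, 2 * etaEvent M a Λ ω m - (s : ℂ) +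
      eulerGaugeα (mass₂ M a Λ ω m) (mass₃ M a Λ s ω m) - 1 ≠ -((n : ℂ) + 1) := by
    intro n
    unfold mass₂ mass₃
    rw [rho_add_eta_sub_one_eq]
    exact nonres_of_real hω m n
  obtain ⟨u, hu, huv⟩ := kB z₂ _ _ _ _ _ _ _ _ v hz₂ hF hroot hρ hre hnr hv
  rw [euler_swap_α, euler_swap_β, euler_swap_γ, euler_swap_δ, euler_swap_ε, euler_swap_q] at hu
  -- gauge glue with the swapped masses (m₁, m₃, m₂, m₄)
  obtain ⟨Rt, hRt, hRtu⟩ := kG z₂ (mass₁ M a Λ s ω m) (mass₃ M a Λ s ω m) (mass₂ M a Λ ω m)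
    (mass₄ M a Λ ω m) (bigE M a Λ s ω m lam) _ u hz₂ hu
  -- exponents of (3.26)
  have he₁ : 2 * etaEvent M a Λ ω m - (s : ℂ) + eulerGaugeα (mass₂ M a Λ ω m) (mass₃ M a Λ s ω m)
        - 1 + eulerGaugeδ (mass₁ M a Λ s ω m) (mass₃ M a Λ s ω m) / 2 =
      1 / 2 + etaCauchy M a Λ ω m + etaEvent M a Λ ω m := by
    unfold mass₁ mass₂ mass₃
    rw [eulerGaugeα_eta, eulerGaugeδ_swap_eta]
    ring
  have he₂ : eulerGaugeε (mass₂ M a Λ ω m) (mass₄ M a Λ ω m) / 2 =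
      1 / 2 - etaCauchy M a Λ ω m - etaCosmo M a Λ ω m := by
    unfold mass₂ mass₄
    rw [eulerGaugeε_swap_eta]
    ring
  rw [he₁, he₂] at hRt
  -- the coefficient of (3.25) = (3.11) with m₂ ↔ m₃ on (1, z₂)
  have hsub' := hsub
  obtain ⟨hM, hΛ, h01, h12, -⟩ := hsub'
  have hr₀ : 0 ≤ rMinus M a Λ := rMinus_nonneg M a Λ
  have hcoef : ∀ z ∈ Ioo 1 z₂,
      sqcdCoeff (mass₁ M a Λ s ω m) (mass₃ M a Λ s ω m) (mass₂ M a Λ ω m) (mass₄ M a Λ ω m)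
          (bigE M a Λ s ω m lam) (z₂ : ℂ) z = tildeCoeff M a Λ s ω m lam z := by
    intro z hz
    obtain ⟨hz1, hzz⟩ := hz
    unfold tildeCoeff bigE mass₁ mass₂ mass₃ mass₄
    rw [hz₂def] at hzz ⊢
    unfold zTwo
    symm
    refine ctdcTilde_eq_sqcd_swap (s : ℂ) η₀ η₁ η₂ (ltBlock M a Λ s ω m lam) ?_ ?_ ?_ ?_ ?_ ?_ ?_
    · exact_mod_cast (sub_pos.mpr h01).ne'
    · have : 0 < rCosmo M a Λ + (rMinus M a Λ + rPlus M a Λ + rCosmo M a Λ) := by linarith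
      exact_mod_cast this.ne'
    · have : 0 < rPlus M a Λ + rCosmo M a Λ := by linarith
      exact_mod_cast this.ne'
    · have : (0 : ℝ) < z := by linarith
      exact_mod_cast this.ne'
    · exact sub_ne_zero.mpr (by exact_mod_cast (ne_of_gt hz1))
    · unfold zTwo at hzz
      exact sub_ne_zero.mpr (by exact_mod_cast (ne_of_gt hzz))
    · rw [hz₂def] at hz₂
      unfold zTwo at hz₂
      have : (0 : ℝ) < ctdcZ₂ (rMinus M a Λ) (rPlus M a Λ) (rCosmo M a Λ) := by linarith
      exact_mod_cast this.ne'
  have hRt' : NormalFormModeData z₂ (tildeCoeff M a Λ s ω m lam)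
      (1 / 2 + etaCauchy M a Λ ω m + etaEvent M a Λ ω m)
      (1 / 2 - etaCauchy M a Λ ω m - etaCosmo M a Λ ω m) Rt := hRt.congr hcoef
  -- the real-axis Wronskian identity on the swapped problem, then back through the injectivities
  have hRt0 := k2 M a Λ s ω m lam Rt hsub ha hω hω0 hlam hthird hRt'
  exact hvR (huv (hRtu hRt0))

/-- **CTdC Theorem 3.10, real-axis bullet, spins `s < 1` — PROVED, no cited fact, no open
hypothesis.** With the landed `transfer_holds`, `eulerRLNonRes_holds`, `gaugeGlue_holds` and
`swappedRealAxisVanishing_holds`: on subextremal Kerr–de Sitter with `0 ≤ a`, every classical solution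
of the radial Teukolsky equation on `(r₊, r_c)` that is ingoing at `𝓗⁺` and outgoing at `𝓗⁺_c`
(generic bullets), with `s < 1`, `ω ∈ ℝ∖{0}`, `Im λ̄ = 0` and `m = 0 ∨ ω/m ∉ (Ω_low, Ω_SR)`, vanishes
identically. [cite: CasalsTeixeiradacosta2022, Theorem 3.10 (second bullet), Corollary 3.9, proof Step 2] -/
theorem realAxis_vanishing_lt_one {M a Λ s : ℝ} {ω : ℂ} {m : ℝ} {lam : ℂ}
    {R : ℝ → ℂ} (hsub : IsSubextremal M a Λ) (ha : 0 ≤ a) (hs : s < 1) (hω : ω.im = 0)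
    (hω0 : ω ≠ 0) (hlam : (lambdaBar a Λ s ω m lam).im = 0)
    (hthird : m = 0 ∨
      ¬(superradiantLower M a Λ < ω.re / m ∧ ω.re / m < superradiantUpper M a Λ))
    (hR : IsRadialTeukolskySolution M a Λ s ω m lam R) (hin : IsIngoingAtEventHorizon M a Λ s ω m R)
    (hout : IsOutgoingAtCosmoHorizon M a Λ ω m R) :
    ∀ r ∈ Ioo (rPlus M a Λ) (rCosmo M a Λ), R r = 0 :=
  realAxis_vanishing_of_routeW_nonres_lt_one transfer_holds eulerRLNonRes_holds gaugeGlue_holds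
    swappedRealAxisVanishing_holds hsub ha hs hω hω0 hlam hthird hR hin hout

end RouteW

end Summit.Ventures.KdS
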